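import Literature.Probability.Distributions.GaussianPoincareVariance
import Literature.MathematicalPhysics.QuantumFieldTheory.Balaban1983to89.T4GnomonicWilsonHessian
import HarnessLib

/-!
# Route `LogConcaveChart` — toolkit for the support item `TransportCovarianceTransfer`
(stmt-QuantumFields-23668, child of the transport split of crux `QuadraticCovarianceComparison`,
stmt-QuantumFields-26240): **Poincaré control of linear functionals of the transport displacement**

Setting (the isotropic frame `H₀ = 1`, to which the item reduces by the linear change of variables
`y = H₀^{1/2} x`): `γ = 𝒩(0, I_n)` as Mathlib's product measure `Measure.pi (fun _ => gaussianReal 0 1)`,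
and a `C¹` displacement `e : ℝⁿ → ℝⁿ` (in the item, `e = T − id` for the Brenier map `T`) with the
pointwise derivative bound `|De(x)u|² ≤ δ²|u|²` and the Lipschitz bound `|e x − e y|² ≤ δ²|x − y|²`.

Proved here (sorry-free, standard axioms):

* `sum_sq_dotProduct_apply_single_le` — the transpose bound (Cauchy–Schwarz reused from the tree's
  `Balaban1983to89.T4GnomonicWilsonHessian.dotProduct_sq_le`): `|Lᵀw|² = ∑ᵢ (w·L eᵢ)² ≤ δ²|w|²`
  for a linear `L` with `|Lu|² ≤ δ²|u|²` (pure linear algebra, Cauchy–Schwarz);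
* `lintegral_sq_sub_dotProduct_le` — the Gaussian Poincaré inequality of the tree
  (`Literature.Probability.Distributions.lintegral_sq_sub_le_pi_gaussianReal`, constant `π²/4`,
  DIMENSION-FREE) applied to `φ = w·e`: `∫∫ (w·e(x) − w·e(y))² dγdγ ≤ (π²/4)·δ²|w|²`;
* `integrable_dotProduct_displacement` — `w·e ∈ L¹ ∩ L²(γ)` from the Lipschitz bound;
* `variance_dotProduct_displacement_le` — `Var_γ(w·e) ≤ (π²/8)·δ²|w|²`;
* `integral_mulVec_displacement_sq_le` — for a CENTRED displacement (`∫ eᵢ dγ = 0`, which in the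
  item comes from the centring `∫ xᵢ e^{−A} = 0`) and any matrix `H`:
  `∫ |H e(x)|² dγ ≤ (π²/8)·δ²·‖H‖_F²` — row by row, so NO factor of the dimension `n` appears.
  This is exactly the estimate that designs out the «hidden √n in the e-term» recorded as the
  why-might-fail of crux 26240: the remainder `f∘T − f = 2xᵀH e + eᵀH e + b·e` of a quadratic
  observable has `γ`-variance `O(δ²)·(‖H‖_F² + |b|²) = O(δ²)·rV_f`.

HONEST SCOPE. Helper lemmas toward ONE support item of a sub-line; nothing here proves
`TransportCovarianceTransfer`, `QuadraticCovarianceComparison`, the `LogConcaveChart` thesis, rung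
R2a (`BalabanLadder.NT`) or any summit statement; the Yang–Mills mass gap is NOT proved.
Filed by ideator seat ym-idea-8 (generation 8, lens «dual» = transport side).
-/

namespace Summit.QuantumFields.YangMills.Cruxes.TransportCovarianceTransfer

open MeasureTheory ProbabilityTheory
open scoped NNReal ENNReal

variable {n : ℕ}

/-- **Transpose bound.** If a linear map `L` of `ℝⁿ` satisfies `|Lu|² ≤ δ²|u|²` for all `u`, then for
every `w`, `∑ᵢ (w·L eᵢ)² ≤ δ²|w|²` (i.e. `|Lᵀw| ≤ δ|w|`). [folklore] -/
theorem sum_sq_dotProduct_apply_single_le {δ : ℝ} (L : (Fin n → ℝ) →L[ℝ] (Fin n → ℝ))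
    (hL : ∀ u, L u ⬝ᵥ L u ≤ δ ^ 2 * (u ⬝ᵥ u)) (w : Fin n → ℝ) :
    ∑ i, (w ⬝ᵥ L (Pi.single i 1)) ^ 2 ≤ δ ^ 2 * (w ⬝ᵥ w) := by
  classical
  set z : Fin n → ℝ := fun i => w ⬝ᵥ L (Pi.single i 1) with hz
  -- `z = ∑ᵢ zᵢ • eᵢ`, hence `L z = ∑ᵢ zᵢ • L eᵢ` and `w·Lz = ∑ᵢ zᵢ²`
  have hzsum : z = ∑ i, z i • (Pi.single i (1 : ℝ) : Fin n → ℝ) := by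
    funext j
    simp only [Finset.sum_apply, Pi.smul_apply, Pi.single_apply, smul_eq_mul, mul_ite, mul_one,
      mul_zero, Finset.sum_ite_eq, Finset.mem_univ, if_true]
  have hLz : L z = ∑ i, z i • L (Pi.single i 1) := by
    conv_lhs => rw [hzsum]
    rw [map_sum]
    refine Finset.sum_congr rfl fun i _ => ?_
    rw [map_smul]
  have hS : ∑ i, z i ^ 2 = w ⬝ᵥ L z := by
    rw [hLz, dotProduct_sum]
    refine Finset.sum_congr rfl fun i _ => ?_
    rw [dotProduct_smul, smul_eq_mul, sq]
  have hS0 : 0 ≤ ∑ i, z i ^ 2 := Finset.sum_nonneg fun i _ => sq_nonneg _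
  have hzz : z ⬝ᵥ z = ∑ i, z i ^ 2 := by simp only [dotProduct, sq]
  -- Cauchy–Schwarz: `(∑ zᵢ²)² = (w·Lz)² ≤ |w|²|Lz|² ≤ |w|² δ² |z|²`
  have hcs : (∑ i, z i ^ 2) ^ 2 ≤ (w ⬝ᵥ w) * (δ ^ 2 * ∑ i, z i ^ 2) := by
    calc (∑ i, z i ^ 2) ^ 2 = (w ⬝ᵥ L z) ^ 2 := by rw [hS]
      _ ≤ (w ⬝ᵥ w) * (L z ⬝ᵥ L z) := Literature.MathematicalPhysics.QuantumFieldTheory.Balaban1983to89.T4GnomonicWilsonHessian.dotProduct_sq_le w (L z)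
      _ ≤ (w ⬝ᵥ w) * (δ ^ 2 * (z ⬝ᵥ z)) := by
          have hw : 0 ≤ w ⬝ᵥ w := by
            simp only [dotProduct]; exact Finset.sum_nonneg fun i _ => mul_self_nonneg _
          exact mul_le_mul_of_nonneg_left (hL z) hw
      _ = (w ⬝ᵥ w) * (δ ^ 2 * ∑ i, z i ^ 2) := by rw [hzz]
  rcases hS0.lt_or_eq with hpos | hzero
  · have h2 : (∑ i, z i ^ 2) * (∑ i, z i ^ 2) ≤ (δ ^ 2 * (w ⬝ᵥ w)) * ∑ i, z i ^ 2 := by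
      calc (∑ i, z i ^ 2) * (∑ i, z i ^ 2) = (∑ i, z i ^ 2) ^ 2 := by ring
        _ ≤ (w ⬝ᵥ w) * (δ ^ 2 * ∑ i, z i ^ 2) := hcs
        _ = (δ ^ 2 * (w ⬝ᵥ w)) * ∑ i, z i ^ 2 := by ring
    exact le_of_mul_le_mul_right h2 hpos
  · rw [← hzero]
    have hw : 0 ≤ w ⬝ᵥ w := by
      simp only [dotProduct]; exact Finset.sum_nonneg fun i _ => mul_self_nonneg _
    positivity

/-- The linear functional `v ↦ w·v` as a continuous linear map (no new definition: an explicit sum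
of coordinate projections), with its action. [folklore] -/
theorem exists_clm_dotProduct (w : Fin n → ℝ) :
    ∃ Λ : (Fin n → ℝ) →L[ℝ] ℝ, ∀ v, Λ v = w ⬝ᵥ v := by
  refine ⟨∑ i, w i • ContinuousLinearMap.proj i, fun v => ?_⟩
  simp [dotProduct]

/-- `x ↦ w·e(x)` is `C¹` when `e` is, and `∂ᵤ(w·e)(x) = w·(De(x)u)`. [folklore] -/
theorem contDiff_dotProduct_comp {e : (Fin n → ℝ) → (Fin n → ℝ)} (he : ContDiff ℝ 1 e)
    (w : Fin n → ℝ) :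
    ContDiff ℝ 1 (fun x => w ⬝ᵥ e x) ∧
      ∀ x u, fderiv ℝ (fun x => w ⬝ᵥ e x) x u = w ⬝ᵥ fderiv ℝ e x u := by
  obtain ⟨Λ, hΛ⟩ := exists_clm_dotProduct w
  have hfun : (fun x => w ⬝ᵥ e x) = fun x => Λ (e x) := by
    funext x; rw [hΛ]
  refine ⟨?_, fun x u => ?_⟩
  · rw [hfun]
    exact Λ.contDiff.comp he
  · have hd : DifferentiableAt ℝ e x := (he.differentiable one_ne_zero) x
    have h := (Λ.hasFDerivAt.comp x hd.hasFDerivAt).fderiv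
    rw [hfun]
    change fderiv ℝ (Λ ∘ e) x u = _
    rw [h, ContinuousLinearMap.comp_apply, hΛ]

/-- **Poincaré for linear functionals of the displacement (interpolation form).** For `γ = 𝒩(0, I_n)`,
`e ∈ C¹` with `|De(x)u|² ≤ δ²|u|²`: `∫∫ (w·e(x) − w·e(y))² dγ(x)dγ(y) ≤ (π²/4)·δ²|w|²` — the
tree's dimension-free Gaussian Poincaré inequality with the transpose bound inserted. [folklore] -/
theorem lintegral_sq_sub_dotProduct_le {δ : ℝ} {e : (Fin n → ℝ) → (Fin n → ℝ)}
    (he : ContDiff ℝ 1 e) (hD : ∀ x u, fderiv ℝ e x u ⬝ᵥ fderiv ℝ e x u ≤ δ ^ 2 * (u ⬝ᵥ u))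
    (w : Fin n → ℝ) :
    ∫⁻ x, ∫⁻ y, ENNReal.ofReal ((w ⬝ᵥ e x - w ⬝ᵥ e y) ^ 2)
        ∂(Measure.pi fun _ : Fin n => gaussianReal 0 1) ∂(Measure.pi fun _ : Fin n => gaussianReal 0 1) ≤
      ENNReal.ofReal (Real.pi ^ 2 / 4 * (δ ^ 2 * (w ⬝ᵥ w))) := by
  set γ : Measure (Fin n → ℝ) := Measure.pi fun _ : Fin n => gaussianReal 0 1 with hγ
  obtain ⟨hφ, hφd⟩ := contDiff_dotProduct_comp he w
  have key := Literature.Probability.Distributions.lintegral_sq_sub_le_pi_gaussianReal (1 : ℝ≥0) hφ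
  rw [← hγ] at key
  have hw : 0 ≤ w ⬝ᵥ w := by
    simp only [dotProduct]; exact Finset.sum_nonneg fun i _ => mul_self_nonneg _
  -- pointwise bound on the gradient term
  have hpt : ∀ x, ∑ i, (fderiv ℝ (fun x => w ⬝ᵥ e x) x (Pi.single i 1)) ^ 2 ≤ δ ^ 2 * (w ⬝ᵥ w) := by
    intro x
    simp_rw [hφd x]
    exact sum_sq_dotProduct_apply_single_le (fderiv ℝ e x) (hD x) w
  have hR : ∫⁻ x, ENNReal.ofReal (∑ i, (fderiv ℝ (fun x => w ⬝ᵥ e x) x (Pi.single i 1)) ^ 2) ∂γ ≤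
      ENNReal.ofReal (δ ^ 2 * (w ⬝ᵥ w)) := by
    calc ∫⁻ x, ENNReal.ofReal (∑ i, (fderiv ℝ (fun x => w ⬝ᵥ e x) x (Pi.single i 1)) ^ 2) ∂γ
        ≤ ∫⁻ _, ENNReal.ofReal (δ ^ 2 * (w ⬝ᵥ w)) ∂γ :=
          lintegral_mono fun x => ENNReal.ofReal_le_ofReal (hpt x)
      _ = ENNReal.ofReal (δ ^ 2 * (w ⬝ᵥ w)) := by
          rw [lintegral_const, measure_univ, mul_one]
  calc ∫⁻ x, ∫⁻ y, ENNReal.ofReal ((w ⬝ᵥ e x - w ⬝ᵥ e y) ^ 2) ∂γ ∂γ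
      ≤ ENNReal.ofReal (Real.pi ^ 2 / 4 * ((1 : ℝ≥0) : ℝ)) *
          ∫⁻ x, ENNReal.ofReal (∑ i, (fderiv ℝ (fun x => w ⬝ᵥ e x) x (Pi.single i 1)) ^ 2) ∂γ := key
    _ ≤ ENNReal.ofReal (Real.pi ^ 2 / 4 * ((1 : ℝ≥0) : ℝ)) * ENNReal.ofReal (δ ^ 2 * (w ⬝ᵥ w)) := by
          gcongr
    _ = ENNReal.ofReal (Real.pi ^ 2 / 4 * (δ ^ 2 * (w ⬝ᵥ w))) := by
          rw [NNReal.coe_one, mul_one, ← ENNReal.ofReal_mul (by positivity)]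

/-- `|x|² = ∑ xᵢ²` is `γ`-integrable. [folklore] -/
theorem integrable_dotProduct_self_pi_gaussianReal :
    Integrable (fun x : Fin n → ℝ => x ⬝ᵥ x) (Measure.pi fun _ : Fin n => gaussianReal 0 1) := by
  have h : (fun x : Fin n → ℝ => x ⬝ᵥ x) = fun x => ∑ i, x i * x i := by
    funext x; simp only [dotProduct]
  rw [h]
  exact integrable_finsetSum _ fun i _ =>
    Literature.Probability.Distributions.integrable_eval_mul_eval_pi_gaussianReal 1 i i

/-- **Integrability.** If `|e x − e y|² ≤ δ²|x − y|²` and `e` is continuous then `w·e ∈ L¹ ∩ L²(γ)`.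
[folklore] -/
theorem integrable_dotProduct_displacement {δ : ℝ} {e : (Fin n → ℝ) → (Fin n → ℝ)}
    (hec : Continuous e)
    (hLip : ∀ x y, (e x - e y) ⬝ᵥ (e x - e y) ≤ δ ^ 2 * ((x - y) ⬝ᵥ (x - y))) (w : Fin n → ℝ) :
    Integrable (fun x => w ⬝ᵥ e x) (Measure.pi fun _ : Fin n => gaussianReal 0 1) ∧
      Integrable (fun x => (w ⬝ᵥ e x) ^ 2) (Measure.pi fun _ : Fin n => gaussianReal 0 1) := by
  set γ : Measure (Fin n → ℝ) := Measure.pi fun _ : Fin n => gaussianReal 0 1 with hγ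
  have hcont : Continuous fun x => w ⬝ᵥ e x := by
    have h : (fun x => w ⬝ᵥ e x) = fun x => ∑ i, w i * e x i := by
      funext x; simp only [dotProduct]
    rw [h]
    exact continuous_finsetSum _ fun i _ => continuous_const.mul ((continuous_apply i).comp hec)
  have hw : 0 ≤ w ⬝ᵥ w := by
    simp only [dotProduct]; exact Finset.sum_nonneg fun i _ => mul_self_nonneg _
  -- pointwise domination `(w·e x)² ≤ 2(w·e 0)² + 2 δ²|w|²|x|²`
  have hdom : ∀ x, (w ⬝ᵥ e x) ^ 2 ≤ 2 * (w ⬝ᵥ e 0) ^ 2 + 2 * (δ ^ 2 * (w ⬝ᵥ w)) * (x ⬝ᵥ x) := by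
    intro x
    have h1 : w ⬝ᵥ e x = w ⬝ᵥ e 0 + w ⬝ᵥ (e x - e 0) := by
      rw [dotProduct_sub]; ring
    have h2 : (w ⬝ᵥ (e x - e 0)) ^ 2 ≤ (w ⬝ᵥ w) * (δ ^ 2 * (x ⬝ᵥ x)) := by
      calc (w ⬝ᵥ (e x - e 0)) ^ 2 ≤ (w ⬝ᵥ w) * ((e x - e 0) ⬝ᵥ (e x - e 0)) :=
            Literature.MathematicalPhysics.QuantumFieldTheory.Balaban1983to89.T4GnomonicWilsonHessian.dotProduct_sq_le _ _
        _ ≤ (w ⬝ᵥ w) * (δ ^ 2 * ((x - 0) ⬝ᵥ (x - 0))) := mul_le_mul_of_nonneg_left (hLip x 0) hw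
        _ = (w ⬝ᵥ w) * (δ ^ 2 * (x ⬝ᵥ x)) := by rw [sub_zero]
    have h3 : (w ⬝ᵥ e 0 + w ⬝ᵥ (e x - e 0)) ^ 2 ≤
        2 * (w ⬝ᵥ e 0) ^ 2 + 2 * (w ⬝ᵥ (e x - e 0)) ^ 2 := by
      nlinarith [sq_nonneg (w ⬝ᵥ e 0 - w ⬝ᵥ (e x - e 0))]
    rw [h1]
    nlinarith [h2, h3]
  have h2 : Integrable (fun x => (w ⬝ᵥ e x) ^ 2) γ := by
    have hmaj : Integrable (fun x : Fin n → ℝ =>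
        2 * (w ⬝ᵥ e 0) ^ 2 + 2 * (δ ^ 2 * (w ⬝ᵥ w)) * (x ⬝ᵥ x)) γ :=
      (integrable_const _).add (integrable_dotProduct_self_pi_gaussianReal.const_mul _)
    refine hmaj.mono' (hcont.pow 2).aestronglyMeasurable (ae_of_all _ fun x => ?_)
    rw [Real.norm_eq_abs, abs_of_nonneg (sq_nonneg _)]
    exact hdom x
  have h1 : Integrable (fun x => w ⬝ᵥ e x) γ := by
    have hm : MemLp (fun x => w ⬝ᵥ e x) 2 γ :=
      (memLp_two_iff_integrable_sq hcont.aestronglyMeasurable).2 h2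
    exact hm.integrable one_le_two
  exact ⟨h1, h2⟩

/-- **Variance form.** For `γ = 𝒩(0, I_n)`, `e ∈ C¹` with `|De(x)u|² ≤ δ²|u|²` and `w·e ∈ L¹ ∩ L²(γ)`:
`∫ (w·e)² dγ − (∫ w·e dγ)² ≤ (π²/8)·δ²|w|²`. [folklore] -/
theorem variance_dotProduct_displacement_le {δ : ℝ} {e : (Fin n → ℝ) → (Fin n → ℝ)}
    (he : ContDiff ℝ 1 e) (hD : ∀ x u, fderiv ℝ e x u ⬝ᵥ fderiv ℝ e x u ≤ δ ^ 2 * (u ⬝ᵥ u))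
    (w : Fin n → ℝ)
    (h1 : Integrable (fun x => w ⬝ᵥ e x) (Measure.pi fun _ : Fin n => gaussianReal 0 1))
    (h2 : Integrable (fun x => (w ⬝ᵥ e x) ^ 2) (Measure.pi fun _ : Fin n => gaussianReal 0 1)) :
    ∫ x, (w ⬝ᵥ e x) ^ 2 ∂(Measure.pi fun _ : Fin n => gaussianReal 0 1) -
        (∫ x, w ⬝ᵥ e x ∂(Measure.pi fun _ : Fin n => gaussianReal 0 1)) ^ 2 ≤
      Real.pi ^ 2 / 8 * (δ ^ 2 * (w ⬝ᵥ w)) := by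
  set γ : Measure (Fin n → ℝ) := Measure.pi fun _ : Fin n => gaussianReal 0 1 with hγ
  set φ : (Fin n → ℝ) → ℝ := fun x => w ⬝ᵥ e x with hφdef
  have key := lintegral_sq_sub_dotProduct_le he hD w
  rw [← hγ] at key
  have hw : 0 ≤ w ⬝ᵥ w := by
    simp only [dotProduct]; exact Finset.sum_nonneg fun i _ => mul_self_nonneg _
  set m : ℝ := ∫ x, φ x ∂γ with hm
  set s : ℝ := ∫ x, φ x ^ 2 ∂γ with hs
  have hin : ∀ x, ∫⁻ y, ENNReal.ofReal ((φ x - φ y) ^ 2) ∂γ =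
      ENNReal.ofReal (∫ y, (φ x - φ y) ^ 2 ∂γ) :=
    fun x => (ofReal_integral_eq_lintegral_ofReal
      (Literature.Probability.Distributions.integrable_sq_sub γ h1 h2 (φ x))
      (ae_of_all _ fun y => sq_nonneg _)).symm
  have hout_int : Integrable (fun x => ∫ y, (φ x - φ y) ^ 2 ∂γ) γ := by
    have e1 : (fun x => ∫ y, (φ x - φ y) ^ 2 ∂γ) = fun x => φ x ^ 2 - 2 * φ x * m + s := by
      funext x
      rw [Literature.Probability.Distributions.integral_sq_sub_eq γ h1 h2]
    rw [e1]
    exact (h2.sub ((h1.const_mul 2).mul_const m)).add (integrable_const _)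
  have hL : ∫⁻ x, ∫⁻ y, ENNReal.ofReal ((φ x - φ y) ^ 2) ∂γ ∂γ =
      ENNReal.ofReal (2 * s - 2 * m ^ 2) := by
    simp_rw [hin]
    rw [← ofReal_integral_eq_lintegral_ofReal hout_int
      (ae_of_all _ fun x => integral_nonneg fun y => sq_nonneg _),
      Literature.Probability.Distributions.integral_integral_sq_sub γ h1 h2]
  have key' : ENNReal.ofReal (2 * s - 2 * m ^ 2) ≤
      ENNReal.ofReal (Real.pi ^ 2 / 4 * (δ ^ 2 * (w ⬝ᵥ w))) := by
    have := key
    simp only [hφdef] at hL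
    rw [hL] at this
    exact this
  have hpos : 0 ≤ Real.pi ^ 2 / 4 * (δ ^ 2 * (w ⬝ᵥ w)) := by positivity
  have := (ENNReal.ofReal_le_ofReal_iff hpos).1 key'
  rw [hs, hm] at this
  linarith

/-- **No hidden `√n`: Frobenius control of `H e` for a centred displacement.** For `γ = 𝒩(0, I_n)`,
`e ∈ C¹` with `|De(x)u|² ≤ δ²|u|²`, `|e x − e y|² ≤ δ²|x − y|²` and `∫ eᵢ dγ = 0` for all `i`, and any
matrix `H`: `∫ |H e(x)|² dγ ≤ (π²/8)·δ²·∑ᵢⱼ Hᵢⱼ²` (row-wise Poincaré; the rows' means vanish). [folklore] -/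
theorem integral_mulVec_displacement_sq_le {δ : ℝ} {e : (Fin n → ℝ) → (Fin n → ℝ)}
    (he : ContDiff ℝ 1 e) (hD : ∀ x u, fderiv ℝ e x u ⬝ᵥ fderiv ℝ e x u ≤ δ ^ 2 * (u ⬝ᵥ u))
    (hLip : ∀ x y, (e x - e y) ⬝ᵥ (e x - e y) ≤ δ ^ 2 * ((x - y) ⬝ᵥ (x - y)))
    (hc : ∀ i, ∫ x, e x i ∂(Measure.pi fun _ : Fin n => gaussianReal 0 1) = 0)
    (H : Matrix (Fin n) (Fin n) ℝ) :
    ∫ x, H.mulVec (e x) ⬝ᵥ H.mulVec (e x) ∂(Measure.pi fun _ : Fin n => gaussianReal 0 1) ≤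
      Real.pi ^ 2 / 8 * (δ ^ 2 * ∑ i, ∑ j, H i j ^ 2) := by
  set γ : Measure (Fin n → ℝ) := Measure.pi fun _ : Fin n => gaussianReal 0 1 with hγ
  have hec : Continuous e := he.continuous
  -- `|H e x|² = ∑ᵢ (Hᵢ·e x)²`
  have hsq : ∀ x, H.mulVec (e x) ⬝ᵥ H.mulVec (e x) = ∑ i, (H i ⬝ᵥ e x) ^ 2 := by
    intro x
    simp only [dotProduct, Matrix.mulVec, sq]
  simp_rw [hsq]
  have hint : ∀ i, Integrable (fun x => (H i ⬝ᵥ e x) ^ 2) γ :=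
    fun i => (integrable_dotProduct_displacement hec hLip (H i)).2
  rw [integral_finsetSum _ fun i _ => hint i]
  -- each row: mean zero, Poincaré
  have hmean : ∀ i, ∫ x, H i ⬝ᵥ e x ∂γ = 0 := by
    intro i
    have h : (fun x => H i ⬝ᵥ e x) = fun x => ∑ j, H i j * e x j := by
      funext x; simp only [dotProduct]
    have hintj : ∀ j, Integrable (fun x => e x j) γ := by
      intro j
      have h1 := (integrable_dotProduct_displacement hec hLip (Pi.single j 1)).1
      refine h1.congr (ae_of_all _ fun x => ?_)
      simp only [single_dotProduct, one_mul]
    rw [h, integral_finsetSum _ fun j _ => (hintj j).const_mul _]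
    refine Finset.sum_eq_zero fun j _ => ?_
    rw [integral_const_mul, hc j, mul_zero]
  have hrow : ∀ i, ∫ x, (H i ⬝ᵥ e x) ^ 2 ∂γ ≤ Real.pi ^ 2 / 8 * (δ ^ 2 * (H i ⬝ᵥ H i)) := by
    intro i
    obtain ⟨h1, h2⟩ := integrable_dotProduct_displacement hec hLip (H i)
    have hv := variance_dotProduct_displacement_le he hD (H i) h1 h2
    rw [← hγ] at hv h1 h2
    rw [hmean i] at hv
    simpa using hv
  calc ∑ i, ∫ x, (H i ⬝ᵥ e x) ^ 2 ∂γ ≤ ∑ i, Real.pi ^ 2 / 8 * (δ ^ 2 * (H i ⬝ᵥ H i)) :=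
        Finset.sum_le_sum fun i _ => hrow i
    _ = Real.pi ^ 2 / 8 * (δ ^ 2 * ∑ i, ∑ j, H i j ^ 2) := by
        rw [← Finset.mul_sum, ← Finset.mul_sum]
        congr 2
        refine Finset.sum_congr rfl fun i _ => ?_
        simp only [dotProduct, sq]

end Summit.QuantumFields.YangMills.Cruxes.TransportCovarianceTransfer
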